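import Mathlib.GroupTheory.Perm.Basic
import Mathlib.Data.Fintype.Perm
import Mathlib.Data.Fin.VecNotation
import Mathlib.Order.Monotone.Basic
import Mathlib.Data.Finset.Card
import HarnessLib

/-!
# Bruhat intervals of the symmetric group as rook boards (Sjöstrand 2007)

Topic `Literature/Combinatorics/Enumerative` (combinatorics of permutations / Coxeter groups of
type A). One NAMED FACT, filed by a grounder for the support item `SmoothIsBoard`
(`stmt-ValiantsHypothesis-13597`) of route `ValiantsHypothesis/PartialSorting`
(`Summit.ValiantsHypothesis.ValiantsHypothesis.Theses.PartialSorting.SmoothIsBoard`): lower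
Bruhat intervals `[id, π]` of pattern-avoiding permutations are exactly the sets of rook
placements on a skew Ferrers board.

## Content

* `permRank x i j = #{a ≤ i : j ≤ x a}` — the rank function `x[i,j]` of Björner–Brenti 2005
  ((2.2), p. 30), written `0`-indexed on `Fin n`.
* `bruhatLE x y : Prop` — **Bruhat order on `𝔖ₙ`**, DEFINED by the rank (tableau) criterion of
  Björner–Brenti 2005, Thm 2.1.5: "Let `x, y ∈ Sₙ`. Then `x ≤ y` if and only if
  `x[i,j] ≤ y[i,j]` for all `i, j ∈ [n]`." Neither Mathlib nor this tree has the Bruhat order of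
  a Coxeter group (grep `Bruhat`: only Choquet-Bruhat / Bruhat functions), and the subword /
  reflection definitions (BB §2.1) would need reduced words; the rank criterion is the standard
  computable characterisation and is the form in which the route states all its items.
* `PermContainsPattern v p` — pattern containment (classical: some subsequence of the one-line
  notation of `v` is order-isomorphic to `p`).
* `IsRightAlignedFerrers S` — Sjöstrand's right-aligned Ferrers (zero-one) matrices, as finsets of
  cells `(row, column)`: "every one-entry has one-entries directly to the right and above it"
  (§2), stated in the equivalent closed form (all cells to the right in the same row and all
  cells above in the same column belong to `S`).
* `Sjostrand2007_Thm_3_1` — the NAMED FACT (the `⇐` half of the main theorem, Thm 3.1 of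
  arXiv:math/0601615 = J. Combin. Theory Ser. A 114 (2007) 1182–1198): if `π ∈ 𝔖ₙ` avoids
  `4231, 35142, 42513, 351624` then the rook configurations with `n` rooks on the right hull
  `H_R(π)` — a right-aligned skew Ferrers matrix `λ ∖ μ` — are exactly the elements of `[id, π]`.

## Source (materialised and read: arXiv:math/0601615, §2–3)

* J. Sjöstrand, *Bruhat intervals as rooks on skew Ferrers boards*, JCTA 114 (2007), Thm 3.1:
  "`𝔖(H_R(π))` equals the lower Bruhat interval `[id, π]` in `𝔖ₙ` if and only if `π` avoids the
  patterns 4231, 35142, 42513, and 351624." Here `𝔖(A)` is "the set of rook configurations on `A`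
  with `n` rooks", identified with permutations "so that `π(i) = j` if and only if there is a rook
  at the square `(i, j)`", and `H_R(π)` is "the smallest right-aligned skew Ferrers matrix that
  covers `π`", a skew Ferrers matrix being "the difference `λ − μ` between a Ferrers matrix `λ` and
  an equally aligned componentwise smaller Ferrers matrix `μ`" (§3); Remark 3.2: these `π` are
  exactly Gasharov–Reiner's permutations "defined by inclusions".
* A. Björner, F. Brenti, *Combinatorics of Coxeter Groups*, GTM 231 (2005), Thm 2.1.5 (rank
  criterion for Bruhat order on `Sₙ`).
* Used in the same form by S. Chepuri, M. Sherman-Bennett, arXiv:2002.07851, Prop. 3.5 (upper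
  intervals `[v, w₀]`, reversed patterns 1324, 24153, 31524, 426153).

## Faithfulness / design notes (for reviewers)

* Only the `⇐` direction is vendored, and the right hull `H_R(π)` (the *smallest* covering
  right-aligned skew Ferrers matrix) is weakened to *some* right-aligned skew Ferrers matrix
  `λ ∖ μ`, `μ ⊆ λ`: this is implied by the printed statement and is all the route consumes
  (`SmoothIsBoard` asks for some board `B` with `σ ≤ π ↔ ∀ a, (a, σ a) ∈ B`); it avoids
  formalising "smallest". No converse, no `q`-rook / Poincaré-polynomial content (Cor. 3.3).
* Bruhat order enters through `bruhatLE` (rank criterion). Indices are `0`-based (`Fin n`); the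
  printed ones are `1`-based — an order-preserving relabelling, immaterial for ranks, patterns and
  Ferrers shapes.
* Sanity check run by the filer (not part of the fact): brute force over `𝔖ₙ`, `n ≤ 6`, of the
  displayed consequence "`{σ : Γ(σ) ⊆ ⋃_{u ≤ π} Γ(u)} = [id, π]` for `π` avoiding the four
  patterns" — 1, 2, 6, 23, 101, 477 avoiders, 0 mismatches.
-/

namespace Literature.Combinatorics.Enumerative

/-- The **rank function** of a map `x : Fin n → Fin n` (a permutation in the applications):
`x[i,j] = #{a ≤ i : x a ≥ j}`, Björner–Brenti 2005 (2.2), `0`-indexed. [cite: BjornerBrenti2005, (2.2)] -/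
def permRank {n : ℕ} (x : Fin n → Fin n) (i j : Fin n) : ℕ :=
  (Finset.univ.filter (fun a : Fin n => a ≤ i ∧ j ≤ x a)).card

/-- **Bruhat order on the symmetric group `𝔖ₙ`**, defined by the rank criterion of
Björner–Brenti 2005, Thm 2.1.5: "`x ≤ y` if and only if `x[i,j] ≤ y[i,j]` for all
`i, j ∈ [n]`." [cite: BjornerBrenti2005, Thm 2.1.5] -/
def bruhatLE {n : ℕ} (x y : Equiv.Perm (Fin n)) : Prop :=
  ∀ i j : Fin n, permRank x i j ≤ permRank y i j

/-- **Pattern containment**: the permutation `v ∈ 𝔖ₙ` contains the pattern `p` (a word of length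
`m` with distinct letters, e.g. `![4,2,3,1]`) if some increasing sequence of `m` positions of
`v` carries values in the same relative order as `p`. [cite: Sjostrand2007, §3] -/
def PermContainsPattern {n m : ℕ} (v : Equiv.Perm (Fin n)) (p : Fin m → ℕ) : Prop :=
  ∃ f : Fin m → Fin n, StrictMono f ∧ ∀ a b : Fin m, (p a < p b ↔ v (f a) < v (f b))

/-- A set of cells `S ⊆ [n] × [n]` (first coordinate = row, second = column) is a
**right-aligned Ferrers matrix** (Sjöstrand 2007, §2: "every one-entry has one-entries directly
to the right and above it", iterated): with every cell it contains all cells to its right in the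
same row and all cells above it in the same column. [cite: Sjostrand2007, §2] -/
def IsRightAlignedFerrers {n : ℕ} (S : Finset (Fin n × Fin n)) : Prop :=
  ∀ i j : Fin n, (i, j) ∈ S → (∀ j' : Fin n, j ≤ j' → (i, j') ∈ S) ∧ (∀ i' : Fin n, i' ≤ i → (i', j) ∈ S)

/-- NAMED FACT — **Sjöstrand 2007, Thm 3.1 (`⇐` half): lower Bruhat intervals of
`{4231, 35142, 42513, 351624}`-avoiding permutations are rook boards.** If `π ∈ 𝔖ₙ` avoids the
patterns `4231`, `35142`, `42513` and `351624`, then there is a right-aligned skew Ferrers matrix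
`λ ∖ μ` (`μ ⊆ λ` right-aligned Ferrers matrices; in print: the right hull `H_R(π)`) whose rook
configurations with `n` rooks are exactly the permutations `σ ≤ π` in Bruhat order
(`bruhatLE`, rank criterion): "`𝔖(H_R(π))` equals the lower Bruhat interval `[id, π]` in `𝔖ₙ` if
and only if `π` avoids the patterns 4231, 35142, 42513, and 351624." Users take
`(h : Sjostrand2007_Thm_3_1)`; grounds
`Summit.ValiantsHypothesis.ValiantsHypothesis.Theses.PartialSorting.SmoothIsBoard`
(take `B := λ \ μ`). [cite: Sjostrand2007, Thm 3.1] -/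
def Sjostrand2007_Thm_3_1 : Prop :=
  ∀ (n : ℕ) (π : Equiv.Perm (Fin n)),
    ¬ PermContainsPattern π ![4, 2, 3, 1] →
    ¬ PermContainsPattern π ![3, 5, 1, 4, 2] →
    ¬ PermContainsPattern π ![4, 2, 5, 1, 3] →
    ¬ PermContainsPattern π ![3, 5, 1, 6, 2, 4] →
      ∃ lam mu : Finset (Fin n × Fin n),
        IsRightAlignedFerrers lam ∧ IsRightAlignedFerrers mu ∧ mu ⊆ lam ∧
          ∀ σ : Equiv.Perm (Fin n), (∀ i : Fin n, (i, σ i) ∈ lam \ mu) ↔ bruhatLE σ π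

end Literature.Combinatorics.Enumerative
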